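import Summits.BirchSwinnertonDyer.BirchSwinnertonDyer.Theorems.ByReductionTypeAtTwoMultTransportRankCert
import Summits.BirchSwinnertonDyer.BirchSwinnertonDyer.Theorems.Rank2ObservatoryKrausMinimality
import Summits.BirchSwinnertonDyer.Rank1Residual.X5.TwoAdicInstancesT42AnchorsRS1
import Summits.BirchSwinnertonDyer.Rank1Residual.X5.TwoAdicInstancesT42AnchorsRS2
import Summits.BirchSwinnertonDyer.Rank1Residual.X5.TwoAdicInstancesT42AnchorsRS3
import Summits.BirchSwinnertonDyer.Rank1Residual.X5.TwoAdicInstancesT42AnchorsRS4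
import Summits.BirchSwinnertonDyer.Rank1Residual.X5.TwoAdicInstancesT42AnchorsRS5
import Summits.BirchSwinnertonDyer.Rank1Residual.X5.TwoAdicInstancesT42AnchorsRS6
import HarnessLib

/-!
# X5 at `p = 2` (cell `bsd-2adic`, seat `bsd-2adic-t42`, GEN 8): KERNEL RANK CERTIFICATES for the rank-aware GV-mult
# anchors `322d1`, `322d2`, `574h1`, `1170i2`, `1246h1`, `4382a1`, `5986b1`, `10718b1` (`m = 1`) and `282b1` (`m = 2`) — the displayed binder `hrankA` of the rank-aware class files DISCHARGED

HONEST FRAMING (cell `bsd-2adic`, run/shared/lean/pub/bsd-2adic/, HUMAN RULINGS D-0036 / D-0054): research route; NO door theorem,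
nothing booked; BSD is not proved by any of this. PARTITION: X5@2 multiplicative (K4ᵐ, RESIDUAL-MAP B1·O1; the 25 RANK-AWARE
rows of tranche 1, HOME/t42/DESIGN-T42-ADDENDUM-8.md A8.5) × p = 2 — types-the-object-of (closes none).
WHAT: for each rank-aware anchor `A` of these rows the binder
`hrankA : ∀ κ : ZpExtension ℚ 2, κ.IsCyclotomic → m ≤ (A.baseChange (κ.layer k)).mordellWeilRank` of
`O1.anchor_invariants_of_prop514_rank_{nonsplit,split}` (GEN 7 displayed it as a RECORD binder, Cremona `allgens`) is PROVED
in the kernel as `rankCert_<A>`, from EXPLICIT RATIONAL POINTS by the tree theorems of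
`Theorems/ByReductionTypeAtTwoMultTransportRankCert.lean` (this seat, GEN 8): `m = 1` (any layer `k`) from ONE point of `A(ℚ)`
with an odd prime in the denominator of its `x`-coordinate (kind `NL`, Silverman AEC VII.3.4: infinite order; Mordell–Weil;
`rank E(ℚ) ≤ rank E(ℚ_k)`); `m = 2`, `k = 1` from such a point on `A` AND one on a GLOBAL MINIMAL MODEL `B` of the quadratic
twist `A^{(2)}` (`C • B = A.quadraticTwist 2` decided by the kernel; `B` minimal by Kraus at `2` — `2⁸ ∤ c₄`, `2⁸ ∤ c₆ + 64` —
and `gcd(Δ, c₄)` a power of `2` at the odd primes; `√2 ∈ ℚ_1` and AEC Exercise 10.16 give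
`rank A(ℚ_1) = rank A(ℚ) + rank A^{(2)}(ℚ) ≥ 2`). The points are multiples `n·P` (or `n·P + T`) of Cremona's generators
(`allgens`), resp. PARI `ellrank` points for the two twists beyond Cremona's range (kit j272015: conductors 764736, 3100864) —
DATA SOURCES only: every statement below is decided by the kernel (`norm_num` / `decide`), nothing is a hypothesis.
WHAT THIS IS NOT: not an upper bound on any rank; not a certificate of `λ_an` (those stay the displayed two-engine rows
`hlanA`/`hμanA`); not a door; no class closes here.

References: [SilvermanAEC2009] VII.3.4, VIII.6.7, Exercise 10.16, III.3.1(b), VII.1 Remark 1.1; [Kraus1989] Prop. 2;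
[Washington1997] §13.1; [GreenbergLNM1716] Thm. 1.9 (consumer); [CremonaAlgorithms1997] Table 1 (322d1, 322d2, 574h1, 1170i2, 1246h1, 4382a1, 5986b1, 10718b1, 282b1).
-/

set_option autoImplicit false

noncomputable section

open WeierstrassCurve Literature.NumberTheory.EllipticCurves
  Summit.BirchSwinnertonDyer.BirchSwinnertonDyer.Theorems.MultRankCert
  Summit.BirchSwinnertonDyer.BirchSwinnertonDyer.Rank2Observatory

namespace Summit.BirchSwinnertonDyer.Rank1Residual.X5.Instances

/-! ## §0 The odd-prime part of global minimality from the prime factors of `gcd(Δ, c₄)` -/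

/-- **Silverman's criterion at the odd primes, finite form**: if every prime factor `q` of `gcd(Δ, c₄)` is `2` or has
`q¹² ∤ Δ`, then every ODD prime `q` has `q¹² ∤ Δ` or `q ∤ c₄` (a prime with `q ∣ Δ` and `q ∣ c₄` divides the `gcd`). The
shape consumed by `Rank2Observatory.isGloballyMinimal_baseChange_int_of_kraus`; on literal models `gcd` by `decide`, its
prime factors by `simp`, the finite check by `decide`. [cite: SilvermanAEC2009, VII.1 Remark 1.1] -/
theorem odd_minimality_criterion_of_primeFactors_gcd (W₀ : WeierstrassCurve ℤ) {S : Finset ℕ}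
    (hg : (Int.gcd W₀.Δ W₀.c₄).primeFactors = S) {D : ℤ} (hD : W₀.Δ = D) (hD0 : D ≠ 0)
    (h : ∀ q ∈ S, q = 2 ∨ ¬ ((q : ℤ) ^ 12 ∣ D)) :
    ∀ q : ℕ, q.Prime → q ≠ 2 → ¬ ((q : ℤ) ^ 12 ∣ W₀.Δ) ∨ ¬ ((q : ℤ) ∣ W₀.c₄) := by
  intro q hq hq2
  by_contra hc
  rw [not_or, not_not, not_not] at hc
  obtain ⟨h12, h4⟩ := hc
  have hqD : (q : ℤ) ∣ W₀.Δ := (dvd_pow_self (q : ℤ) (by norm_num)).trans h12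
  have hgz : (q : ℤ) ∣ (Int.gcd W₀.Δ W₀.c₄ : ℤ) := Int.dvd_coe_gcd hqD h4
  have hgn : q ∣ Int.gcd W₀.Δ W₀.c₄ := by exact_mod_cast hgz
  have hg0 : Int.gcd W₀.Δ W₀.c₄ ≠ 0 := fun h0 ↦ hD0 (hD ▸ (Int.gcd_eq_zero_iff.mp h0).1)
  have hmem : q ∈ (Int.gcd W₀.Δ W₀.c₄).primeFactors := Nat.mem_primeFactors.mpr ⟨hq, hgn, hg0⟩
  rw [hg] at hmem
  rcases h q hmem with h2 | hn
  · exact hq2 h2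
  · exact hn (hD ▸ h12)

/-! ## Anchor `322d1` (`m = 1`, every layer) -/

/-- **`NL` point on `322d1`**: `3·(0, 2) = (-20/9, 166/27)` lies on `322d1` = `[1, 0, 0, -14, 4]`; its `x`-coordinate has the odd
prime `3` in the denominator (Cremona generator `(0, 2)`). [cite: CremonaAlgorithms1997, Table 1 (322d1)] -/
theorem nl_322d1 : c322d1.toAffine.Nonsingular (-20 / 9 : ℚ) (166 / 27 : ℚ) := by
  rw [← WeierstrassCurve.Affine.equation_iff_nonsingular, c322d1_eq, WeierstrassCurve.Affine.equation_iff]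
  norm_num

/-- **RANK CERTIFICATE for `322d1`: `1 ≤ rank_ℤ 322d1(ℚ_k)` on EVERY layer `ℚ_k` of every cyclotomic `ℤ₂`-extension** —
the binder `hrankA` (`m = 1`) of the rank-aware rows anchored at `322d1`, PROVED: `layerRank_one_of_dvd_den` on the `NL`
point `nl_322d1` (infinite order by AEC VII.3.4; Mordell–Weil; the rank does not drop on base change).
[cite: SilvermanAEC2009, VII.3.4 and Thm. VIII.6.7] [cite: CremonaAlgorithms1997, Table 1 (322d1)] -/
theorem rankCert_322d1 (k : ℕ) :
    ∀ κ : ZpExtension ℚ 2, κ.IsCyclotomic → 1 ≤ (c322d1.baseChange (κ.layer k)).mordellWeilRank :=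
  haveI : Fact (Nat.Prime 3) := ⟨by norm_num⟩
  layerRank_one_of_dvd_den c322d1 3 (by norm_num) nl_322d1 (by norm_num) k

/-! ## Anchor `322d2` (`m = 1`, every layer) -/

/-- **`NL` point on `322d2`**: `6·(6, 4) = (142/9, 1028/27)` lies on `322d2` = `[1, 0, 0, -174, 868]`; its `x`-coordinate has the odd
prime `3` in the denominator (Cremona generator `(6, 4)`). [cite: CremonaAlgorithms1997, Table 1 (322d2)] -/
theorem nl_322d2 : c322d2.toAffine.Nonsingular (142 / 9 : ℚ) (1028 / 27 : ℚ) := by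
  rw [← WeierstrassCurve.Affine.equation_iff_nonsingular, c322d2_eq, WeierstrassCurve.Affine.equation_iff]
  norm_num

/-- **RANK CERTIFICATE for `322d2`: `1 ≤ rank_ℤ 322d2(ℚ_k)` on EVERY layer `ℚ_k` of every cyclotomic `ℤ₂`-extension** —
the binder `hrankA` (`m = 1`) of the rank-aware rows anchored at `322d2`, PROVED: `layerRank_one_of_dvd_den` on the `NL`
point `nl_322d2` (infinite order by AEC VII.3.4; Mordell–Weil; the rank does not drop on base change).
[cite: SilvermanAEC2009, VII.3.4 and Thm. VIII.6.7] [cite: CremonaAlgorithms1997, Table 1 (322d2)] -/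
theorem rankCert_322d2 (k : ℕ) :
    ∀ κ : ZpExtension ℚ 2, κ.IsCyclotomic → 1 ≤ (c322d2.baseChange (κ.layer k)).mordellWeilRank :=
  haveI : Fact (Nat.Prime 3) := ⟨by norm_num⟩
  layerRank_one_of_dvd_den c322d2 3 (by norm_num) nl_322d2 (by norm_num) k

/-! ## Anchor `574h1` (`m = 1`, every layer) -/

/-- **`NL` point on `574h1`**: `2·(1, 2) = (-5/9, -52/27)` lies on `574h1` = `[1, -1, 1, 3, 5]`; its `x`-coordinate has the odd
prime `3` in the denominator (Cremona generator `(1, 2)`). [cite: CremonaAlgorithms1997, Table 1 (574h1)] -/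
theorem nl_574h1 : c574h1.toAffine.Nonsingular (-5 / 9 : ℚ) (-52 / 27 : ℚ) := by
  rw [← WeierstrassCurve.Affine.equation_iff_nonsingular, c574h1_eq, WeierstrassCurve.Affine.equation_iff]
  norm_num

/-- **RANK CERTIFICATE for `574h1`: `1 ≤ rank_ℤ 574h1(ℚ_k)` on EVERY layer `ℚ_k` of every cyclotomic `ℤ₂`-extension** —
the binder `hrankA` (`m = 1`) of the rank-aware rows anchored at `574h1`, PROVED: `layerRank_one_of_dvd_den` on the `NL`
point `nl_574h1` (infinite order by AEC VII.3.4; Mordell–Weil; the rank does not drop on base change).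
[cite: SilvermanAEC2009, VII.3.4 and Thm. VIII.6.7] [cite: CremonaAlgorithms1997, Table 1 (574h1)] -/
theorem rankCert_574h1 (k : ℕ) :
    ∀ κ : ZpExtension ℚ 2, κ.IsCyclotomic → 1 ≤ (c574h1.baseChange (κ.layer k)).mordellWeilRank :=
  haveI : Fact (Nat.Prime 3) := ⟨by norm_num⟩
  layerRank_one_of_dvd_den c574h1 3 (by norm_num) nl_574h1 (by norm_num) k

/-! ## Anchor `1170i2` (`m = 1`, every layer) -/

/-- **`NL` point on `1170i2`**: `2·(25, -2) = (439597/121, -293844900/1331)` lies on `1170i2` = `[1, -1, 1, -503, -2473]`; its `x`-coordinate has the odd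
prime `11` in the denominator (Cremona generator `(25, -2)`). [cite: CremonaAlgorithms1997, Table 1 (1170i2)] -/
theorem nl_1170i2 : c1170i2.toAffine.Nonsingular (439597 / 121 : ℚ) (-293844900 / 1331 : ℚ) := by
  rw [← WeierstrassCurve.Affine.equation_iff_nonsingular, c1170i2_eq, WeierstrassCurve.Affine.equation_iff]
  norm_num

/-- **RANK CERTIFICATE for `1170i2`: `1 ≤ rank_ℤ 1170i2(ℚ_k)` on EVERY layer `ℚ_k` of every cyclotomic `ℤ₂`-extension** —
the binder `hrankA` (`m = 1`) of the rank-aware rows anchored at `1170i2`, PROVED: `layerRank_one_of_dvd_den` on the `NL`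
point `nl_1170i2` (infinite order by AEC VII.3.4; Mordell–Weil; the rank does not drop on base change).
[cite: SilvermanAEC2009, VII.3.4 and Thm. VIII.6.7] [cite: CremonaAlgorithms1997, Table 1 (1170i2)] -/
theorem rankCert_1170i2 (k : ℕ) :
    ∀ κ : ZpExtension ℚ 2, κ.IsCyclotomic → 1 ≤ (c1170i2.baseChange (κ.layer k)).mordellWeilRank :=
  haveI : Fact (Nat.Prime 11) := ⟨by norm_num⟩
  layerRank_one_of_dvd_den c1170i2 11 (by norm_num) nl_1170i2 (by norm_num) k

/-! ## Anchor `1246h1` (`m = 1`, every layer) -/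

/-- **`NL` point on `1246h1`**: `2·(1, 11) = (1/9, -367/27)` lies on `1246h1` = `[1, -1, 1, -30, 173]`; its `x`-coordinate has the odd
prime `3` in the denominator (Cremona generator `(1, 11)`). [cite: CremonaAlgorithms1997, Table 1 (1246h1)] -/
theorem nl_1246h1 : c1246h1.toAffine.Nonsingular (1 / 9 : ℚ) (-367 / 27 : ℚ) := by
  rw [← WeierstrassCurve.Affine.equation_iff_nonsingular, c1246h1_eq, WeierstrassCurve.Affine.equation_iff]
  norm_num

/-- **RANK CERTIFICATE for `1246h1`: `1 ≤ rank_ℤ 1246h1(ℚ_k)` on EVERY layer `ℚ_k` of every cyclotomic `ℤ₂`-extension** —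
the binder `hrankA` (`m = 1`) of the rank-aware rows anchored at `1246h1`, PROVED: `layerRank_one_of_dvd_den` on the `NL`
point `nl_1246h1` (infinite order by AEC VII.3.4; Mordell–Weil; the rank does not drop on base change).
[cite: SilvermanAEC2009, VII.3.4 and Thm. VIII.6.7] [cite: CremonaAlgorithms1997, Table 1 (1246h1)] -/
theorem rankCert_1246h1 (k : ℕ) :
    ∀ κ : ZpExtension ℚ 2, κ.IsCyclotomic → 1 ≤ (c1246h1.baseChange (κ.layer k)).mordellWeilRank :=
  haveI : Fact (Nat.Prime 3) := ⟨by norm_num⟩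
  layerRank_one_of_dvd_den c1246h1 3 (by norm_num) nl_1246h1 (by norm_num) k

/-! ## Anchor `4382a1` (`m = 1`, every layer) -/

/-- **`NL` point on `4382a1`**: `2·(2, 79) = (274/25, -6317/125)` lies on `4382a1` = `[1, 0, 0, -637, 7665]`; its `x`-coordinate has the odd
prime `5` in the denominator (Cremona generator `(2, 79)`). [cite: CremonaAlgorithms1997, Table 1 (4382a1)] -/
theorem nl_4382a1 : c4382a1.toAffine.Nonsingular (274 / 25 : ℚ) (-6317 / 125 : ℚ) := by
  rw [← WeierstrassCurve.Affine.equation_iff_nonsingular, c4382a1_eq, WeierstrassCurve.Affine.equation_iff]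
  norm_num

/-- **RANK CERTIFICATE for `4382a1`: `1 ≤ rank_ℤ 4382a1(ℚ_k)` on EVERY layer `ℚ_k` of every cyclotomic `ℤ₂`-extension** —
the binder `hrankA` (`m = 1`) of the rank-aware rows anchored at `4382a1`, PROVED: `layerRank_one_of_dvd_den` on the `NL`
point `nl_4382a1` (infinite order by AEC VII.3.4; Mordell–Weil; the rank does not drop on base change).
[cite: SilvermanAEC2009, VII.3.4 and Thm. VIII.6.7] [cite: CremonaAlgorithms1997, Table 1 (4382a1)] -/
theorem rankCert_4382a1 (k : ℕ) :
    ∀ κ : ZpExtension ℚ 2, κ.IsCyclotomic → 1 ≤ (c4382a1.baseChange (κ.layer k)).mordellWeilRank :=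
  haveI : Fact (Nat.Prime 5) := ⟨by norm_num⟩
  layerRank_one_of_dvd_den c4382a1 5 (by norm_num) nl_4382a1 (by norm_num) k

/-! ## Anchor `5986b1` (`m = 1`, every layer) -/

/-- **`NL` point on `5986b1`**: `3·(-4, 3) = (-40254/9409, 4465299/912673)` lies on `5986b1` = `[1, 0, 0, -73, -231]`; its `x`-coordinate has the odd
prime `97` in the denominator (Cremona generator `(-4, 3)`). [cite: CremonaAlgorithms1997, Table 1 (5986b1)] -/
theorem nl_5986b1 : c5986b1.toAffine.Nonsingular (-40254 / 9409 : ℚ) (4465299 / 912673 : ℚ) := by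
  rw [← WeierstrassCurve.Affine.equation_iff_nonsingular, c5986b1_eq, WeierstrassCurve.Affine.equation_iff]
  norm_num

/-- **RANK CERTIFICATE for `5986b1`: `1 ≤ rank_ℤ 5986b1(ℚ_k)` on EVERY layer `ℚ_k` of every cyclotomic `ℤ₂`-extension** —
the binder `hrankA` (`m = 1`) of the rank-aware rows anchored at `5986b1`, PROVED: `layerRank_one_of_dvd_den` on the `NL`
point `nl_5986b1` (infinite order by AEC VII.3.4; Mordell–Weil; the rank does not drop on base change).
[cite: SilvermanAEC2009, VII.3.4 and Thm. VIII.6.7] [cite: CremonaAlgorithms1997, Table 1 (5986b1)] -/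
theorem rankCert_5986b1 (k : ℕ) :
    ∀ κ : ZpExtension ℚ 2, κ.IsCyclotomic → 1 ≤ (c5986b1.baseChange (κ.layer k)).mordellWeilRank :=
  haveI : Fact (Nat.Prime 97) := ⟨by norm_num⟩
  layerRank_one_of_dvd_den c5986b1 97 (by norm_num) nl_5986b1 (by norm_num) k

/-! ## Anchor `10718b1` (`m = 1`, every layer) -/

/-- **`NL` point on `10718b1`**: `2·(11, 19) = (21501/625, -3394949/15625)` lies on `10718b1` = `[1, -1, 1, 26, -907]`; its `x`-coordinate has the odd
prime `5` in the denominator (Cremona generator `(11, 19)`). [cite: CremonaAlgorithms1997, Table 1 (10718b1)] -/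
theorem nl_10718b1 : c10718b1.toAffine.Nonsingular (21501 / 625 : ℚ) (-3394949 / 15625 : ℚ) := by
  rw [← WeierstrassCurve.Affine.equation_iff_nonsingular, c10718b1_eq, WeierstrassCurve.Affine.equation_iff]
  norm_num

/-- **RANK CERTIFICATE for `10718b1`: `1 ≤ rank_ℤ 10718b1(ℚ_k)` on EVERY layer `ℚ_k` of every cyclotomic `ℤ₂`-extension** —
the binder `hrankA` (`m = 1`) of the rank-aware rows anchored at `10718b1`, PROVED: `layerRank_one_of_dvd_den` on the `NL`
point `nl_10718b1` (infinite order by AEC VII.3.4; Mordell–Weil; the rank does not drop on base change).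
[cite: SilvermanAEC2009, VII.3.4 and Thm. VIII.6.7] [cite: CremonaAlgorithms1997, Table 1 (10718b1)] -/
theorem rankCert_10718b1 (k : ℕ) :
    ∀ κ : ZpExtension ℚ 2, κ.IsCyclotomic → 1 ≤ (c10718b1.baseChange (κ.layer k)).mordellWeilRank :=
  haveI : Fact (Nat.Prime 5) := ⟨by norm_num⟩
  layerRank_one_of_dvd_den c10718b1 5 (by norm_num) nl_10718b1 (by norm_num) k

/-! ## Anchor `282b1` (`m = 2`, layer `1`): the curve, its `2`-twist `B` (Cremona `9024z1`), the change of variables -/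

/-- Integer model `B` of the quadratic twist of `282b1` by `2`: `[0, 1, 0, -961, 13727]` (Cremona `9024z1`; conductor `32·N(282b1)`).
[cite: CremonaAlgorithms1997, Table 1 (282b1)] -/
abbrev MT282b1 : WeierstrassCurve ℤ := ⟨0, 1, 0, -961, 13727⟩
/-- `B / ℚ`. [cite: CremonaAlgorithms1997, Table 1 (282b1)] -/
abbrev t282b1 : WeierstrassCurve ℚ := MT282b1.baseChange ℚ
/-- `Δ(B)`. [folklore] -/
theorem MT282b1_Δ : MT282b1.Δ = -28387049472 := by decide
/-- `c₄(B)` (`= 64·c₄(282b1)`, `ord₂ = 6`). [folklore] -/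
theorem MT282b1_c₄ : MT282b1.c₄ = 46144 := by decide
/-- `c₆(B)` (`= 512·c₆(282b1)`, `ord₂(c₆ + 64) = 6`). [folklore] -/
theorem MT282b1_c₆ : MT282b1.c₆ = -12136960 := by decide
/-- `B` is an elliptic curve. [folklore] -/
instance t282b1_isElliptic : t282b1.IsElliptic := by
  rw [WeierstrassCurve.isElliptic_iff, baseChange_int_Δ, MT282b1_Δ]; norm_num
/-- **`B` is a global minimal model** — Kraus at `2` (`2⁸ ∤ c₄`, `2⁸ ∤ c₆ + 64`, Tate's first step) and Silverman's criterion at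
the odd primes (prime factors of `gcd(Δ, c₄)` = `{2}`, each odd one with `q¹² ∤ Δ`). [cite: Kraus1989, Prop. 2] [cite: SilvermanAEC2009, VII.1 Remark 1.1] -/
instance t282b1_isGloballyMinimal : t282b1.IsGloballyMinimal := by
  refine isGloballyMinimal_baseChange_int_of_kraus MT282b1 (by rw [MT282b1_c₄]; decide) (by rw [MT282b1_c₆]; decide) ?_
  have hg : (Int.gcd MT282b1.Δ MT282b1.c₄).primeFactors = {2} := by
    rw [MT282b1_Δ, MT282b1_c₄, show Int.gcd (-28387049472 : ℤ) 46144 = 64 by decide]; simp [Nat.primeFactors]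
  exact odd_minimality_criterion_of_primeFactors_gcd MT282b1 hg MT282b1_Δ (by decide) (by decide)
/-- The literal rational model of `B`. [folklore] -/
theorem t282b1_eq : t282b1 = ⟨0, 1, 0, -961, 13727⟩ := by
  rw [t282b1, baseChange_int_eq]; norm_num
/-- **`(2, 3, 0, 0) • B = 282b1^{(2)}`** — `B` is a model of the tree's quadratic twist `c282b1.quadraticTwist 2 = ⟨0, b₂/2, 0, 2b₄, 2b₆⟩`
(decided on the five coefficients). [cite: SilvermanAEC2009, X.§2 and III.1] -/
theorem twist_two_282b1 :
    (⟨Units.mk0 (2 : ℚ) two_ne_zero, 3, 0, 0⟩ : VariableChange ℚ) • t282b1 = c282b1.quadraticTwist 2 := by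
  rw [t282b1_eq, c282b1_eq]
  ext <;> simp [quadraticTwist, b₂, b₄, b₆, variableChange_a₁, variableChange_a₂, variableChange_a₃,
    variableChange_a₄, variableChange_a₆] <;> norm_num
/-- **`NL` point on `282b1`**: `4·(1, 2) = (19/9, 22/27)` (odd prime `3` in the denominator; Cremona generator
`(1, 2)`). [cite: CremonaAlgorithms1997, Table 1 (282b1)] -/
theorem nl_282b1 : c282b1.toAffine.Nonsingular (19 / 9 : ℚ) (22 / 27 : ℚ) := by
  rw [← WeierstrassCurve.Affine.equation_iff_nonsingular, c282b1_eq, WeierstrassCurve.Affine.equation_iff]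
  norm_num
/-- **`NL` point on `B`**: `2·(13, 60)` `= (-12851/900, -4246957/27000)` on `B` (odd prime `3` in the denominator; point source: Cremona `9024z1`).
[cite: CremonaAlgorithms1997, Table 1 (282b1)] -/
theorem nl_t282b1 : t282b1.toAffine.Nonsingular (-12851 / 900 : ℚ) (-4246957 / 27000 : ℚ) := by
  rw [← WeierstrassCurve.Affine.equation_iff_nonsingular, t282b1_eq, WeierstrassCurve.Affine.equation_iff]
  norm_num
/-- **RANK CERTIFICATE for `282b1`: `2 ≤ rank_ℤ 282b1(ℚ_1)` on the first layer `ℚ_1 = ℚ(√2)` of every cyclotomic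
`ℤ₂`-extension** — the binder `hrankA` (`m = 2`, `k = 1`) of the rank-aware row anchored at `282b1`, PROVED:
`two_le_mordellWeilRank_layer_one_of_dvd_den_of_twist` on `nl_282b1`, the twist model `B` (`twist_two_282b1`) and `nl_t282b1`
(`rank A(ℚ_1) = rank A(ℚ) + rank B(ℚ) ≥ 1 + 1`, AEC Ex. 10.16 with `√2 ∈ ℚ_1`).
[cite: SilvermanAEC2009, VII.3.4, Thm. VIII.6.7 and Exercise 10.16] [cite: Washington1997, §13.1] [cite: CremonaAlgorithms1997, Table 1 (282b1)] -/
theorem rankCert_282b1 :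
    ∀ κ : ZpExtension ℚ 2, κ.IsCyclotomic → 2 ≤ (c282b1.baseChange (κ.layer 1)).mordellWeilRank :=
  haveI : Fact (Nat.Prime 3) := ⟨by norm_num⟩
  haveI : Fact (Nat.Prime 3) := ⟨by norm_num⟩
  two_le_mordellWeilRank_layer_one_of_dvd_den_of_twist c282b1 3 (by norm_num) nl_282b1 (by norm_num) t282b1
    ⟨Units.mk0 (2 : ℚ) two_ne_zero, 3, 0, 0⟩ twist_two_282b1 3 (by norm_num) nl_t282b1 (by norm_num)

end Summit.BirchSwinnertonDyer.Rank1Residual.X5.Instances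

end
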